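import Summits.FinalStateConjecture.FinalStateConjecture.Theorems.SwallowTheDatumSubdataDevelopmentsEmbedDoDCausal
import Summits.FinalStateConjecture.FinalStateConjecture.Theorems.SwallowTheDatumSubdataDevelopmentsEmbedDoDExtend
import Summits.FinalStateConjecture.FinalStateConjecture.Theorems.SwallowTheDatumSubdataDevelopmentsEmbedDoDEndpoint
import Literature.Geometry.Lorentzian.DevelopmentImmersionInjective
import Literature.Geometry.Lorentzian.OpensCausality

/-!
# Route SwallowTheDatum · item `SubdataDevelopmentsEmbed` (stmt-FinalStateConjecture-10053) —
# towards the domain of dependence of the sub-datum (`hcauchy`), IV: the SOFT ASSEMBLY — the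
# interior of the timelike domain of dependence of `S ⊆ Σ` is a globally hyperbolic region with
# Cauchy hypersurface `S`, given the local domain-of-dependence property at the points of `S`
# and the endpoint lemma for timelike curves

Let `Σ` be a Cauchy hypersurface of `(M, g, τ)` (Hausdorff, second countable, without boundary,
finite dimension, `C²`) and `S ⊆ Σ`. Write `𝔇(S)` for the timelike domain of dependence (every
endless timelike curve through the point meets `S`, displayed inline) and `V₀ = int 𝔇(S)`.
Assume:

* (`hL`, LOCAL DOMAIN OF DEPENDENCE) every point of `S` has a neighbourhood contained in `𝔇(S)`
  — the property of a SPACELIKE `Σ` and `S` open in `Σ` proved in the sequel files;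
* (`hEp`, `hEf`, ENDPOINT LEMMA) a future timelike curve with a past endpoint `e` lies in
  `I⁺(e)` (except possibly at a least parameter), and dually for future endpoints.

Then (`exists_mem_of_forall_not_hasEndpoint`) every future timelike curve in `V₀` with no
endpoint in `V₀` meets `S`; hence (`isCauchyHypersurface_restrict_of_localDoD`) `S` is a Cauchy
hypersurface of every open `V ⊆ V₀` closed in `V₀` — in particular of the connected component of
`V₀` containing a connected `S` (`exists_opens_isCauchyHypersurface_of_localDoD`), which is the
shape of the hypothesis `hcauchy` of `subdataDevelopmentsEmbed_of_hloc_hcauchy_hncb`. Proof (see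
the module blueprint in the item notes): trichotomy at the base point `p = γ t₀`; if the half of
`γ` towards `Σ` misses `Σ` it is endless in `M` towards `Σ` — then splice an endless extension
away from `Σ` (`exists_isEndlessTimelikeCurve_extends_future` / `…_past`) to contradict the
Cauchy property — or it has an endpoint `e ∉ V₀`, which the endpoint lemma places in `I∓(p)`,
and the causal convexity of `𝔇(S)` towards `Σ` (`forall_endless_of_mem_chronologicalPast` and its
dual) or `hL` puts `e` in `V₀` after all.

No definition, no named fact.
-/

noncomputable section

open Function Set Filter Topology TopologicalSpace Bundle Manifold
open scoped Manifold ContDiff Topology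

namespace Summit.FinalStateConjecture.FinalStateConjecture.Theorems

namespace SubdataDevelopmentsEmbed

open Literature.Geometry.Lorentzian

section Assembly

variable {E : Type*} [NormedAddCommGroup E] [NormedSpace ℝ E] {H : Type*} [TopologicalSpace H]
  {I : ModelWithCorners ℝ E H} {n : ℕ∞ω} {M : Type*} [TopologicalSpace M] [ChartedSpace H M]
  [IsManifold I ∞ M] {g : LorentzianMetric I n M} {τ : TimeOrientation g}
  [T2Space M] [SecondCountableTopology M] [BoundarylessManifold I M] [FiniteDimensional ℝ E]

/-- **The core of the assembly.** With `Σ`, `S ⊆ Σ`, `hL`, `hEp`, `hEf` as in the module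
docstring: a future timelike curve `γ` on an interval `s ∋ t₀` with values in
`V₀ = int 𝔇(S)` and NO ENDPOINT IN `V₀` meets `S`. -/
theorem exists_mem_of_forall_not_hasEndpoint (hn : 2 ≤ n) {Sig S : Set M}
    (hSig : g.IsCauchyHypersurface τ Sig) (hS : S ⊆ Sig)
    (hL : ∀ q ∈ S, ∃ O ∈ 𝓝 q, ∀ p ∈ O, ∀ (δ : ℝ → M) (u : Set ℝ),
      g.IsEndlessTimelikeCurve τ δ u → ∀ r ∈ u, δ r = p → ∃ r' ∈ u, δ r' ∈ S)
    (hEp : ∀ (γ : ℝ → M) (s : Set ℝ) (e : M), s.OrdConnected → g.IsFutureTimelikeCurveOn τ γ s →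
      HasPastEndpoint γ s e → ∀ t ∈ s, ∀ t' ∈ s, t' < t → γ t ∈ g.chronologicalFuture τ {e})
    (hEf : ∀ (γ : ℝ → M) (s : Set ℝ) (e : M), s.OrdConnected → g.IsFutureTimelikeCurveOn τ γ s →
      HasFutureEndpoint γ s e → ∀ t ∈ s, ∀ t' ∈ s, t < t' → e ∈ g.chronologicalFuture τ {γ t})
    {γ : ℝ → M} {s : Set ℝ} (hs : s.OrdConnected) (hγ : g.IsFutureTimelikeCurveOn τ γ s)
    {t₀ : ℝ} (ht₀ : t₀ ∈ s)
    (hγV : ∀ t ∈ s, γ t ∈ interior {p | ∀ (δ : ℝ → M) (u : Set ℝ),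
      g.IsEndlessTimelikeCurve τ δ u → ∀ r ∈ u, δ r = p → ∃ r' ∈ u, δ r' ∈ S})
    (hfe : ∀ e ∈ interior {p | ∀ (δ : ℝ → M) (u : Set ℝ),
      g.IsEndlessTimelikeCurve τ δ u → ∀ r ∈ u, δ r = p → ∃ r' ∈ u, δ r' ∈ S},
      ¬ HasFutureEndpoint γ s e)
    (hpe : ∀ e ∈ interior {p | ∀ (δ : ℝ → M) (u : Set ℝ),
      g.IsEndlessTimelikeCurve τ δ u → ∀ r ∈ u, δ r = p → ∃ r' ∈ u, δ r' ∈ S},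
      ¬ HasPastEndpoint γ s e) :
    ∃ t ∈ s, γ t ∈ S := by
  set DD : Set M := {p | ∀ (δ : ℝ → M) (u : Set ℝ),
      g.IsEndlessTimelikeCurve τ δ u → ∀ r ∈ u, δ r = p → ∃ r' ∈ u, δ r' ∈ S} with hDD
  have hint : ∀ {q : M}, (∃ O ∈ 𝓝 q, ∀ p ∈ O, p ∈ DD) → q ∈ interior DD := fun ⟨O, hO, hOD⟩ ↦
    mem_interior_iff_mem_nhds.2 (mem_of_superset hO fun p hp ↦ hOD p hp)
  set p := γ t₀ with hpdef
  have hpV : p ∈ interior DD := hγV t₀ ht₀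
  have hpD : p ∈ DD := interior_subset hpV
  -- a point of `γ` on `Σ` is in `S`
  have honSig : ∀ t ∈ s, γ t ∈ Sig → γ t ∈ S := fun t hts htSig ↦
    mem_of_mem_of_forall_endless hn hSig hS htSig (interior_subset (hγV t hts))
  by_cases hpSig : p ∈ Sig
  · exact ⟨t₀, ht₀, honSig t₀ ht₀ hpSig⟩
  rcases mem_chronologicalFuture_or_mem_chronologicalPast hn hSig hpSig with hp | hp
  · /- `p ∈ I⁺(Σ)`: look at the past half `D = s ∩ (-∞, t₀]` -/
    by_cases hA : ∃ t ∈ s, t ≤ t₀ ∧ γ t ∈ Sig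
    · obtain ⟨t, hts, -, htSig⟩ := hA
      exact ⟨t, hts, honSig t hts htSig⟩
    push Not at hA
    exfalso
    -- the past half lies in `I⁺(Σ)`
    have hplus : ∀ t ∈ s, t ≤ t₀ → γ t ∈ g.chronologicalFuture τ Sig := by
      intro t hts htle
      rcases eq_or_lt_of_le htle with rfl | hlt
      · exact hp
      by_contra hnot
      obtain ⟨t', ht'I, ht'Sig⟩ := exists_mem_of_isFutureTimelikeCurveOn hn hSig hlt.le
        (hγ.mono (hs.out hts ht₀)) hnot (not_mem_chronologicalPast_of_mem_chronologicalFuture hn hSig hp)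
      exact hA t' (hs.out hts ht₀ ht'I) ht'I.2 ht'Sig
    set D : Set ℝ := s ∩ Iic t₀ with hDdef
    have hDoc : D.OrdConnected := hs.inter ordConnected_Iic
    have ht₀D : t₀ ∈ D := ⟨ht₀, (le_rfl : t₀ ≤ t₀)⟩
    have hDsub : D ⊆ Iic t₀ := inter_subset_right
    have hγD : g.IsFutureTimelikeCurveOn τ γ D := hγ.mono inter_subset_left
    by_cases hend : IsPastEndless γ D
    · -- B1: splice a future-endless extension at `t₀`: an endless timelike curve missing `Σ`
      obtain ⟨Δ, D', hΔ, -, hΔD, hnew⟩ :=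
        LorentzianMetric.exists_isEndlessTimelikeCurve_extends_future hn hDoc ht₀D hDsub hγD hend
      obtain ⟨u, ⟨huD', huSig⟩, -⟩ := hSig Δ D' hΔ
      by_cases huD : u ∈ D
      · rw [hΔD u huD] at huSig
        exact hA u huD.1 huD.2 huSig
      · exact not_mem_of_mem_chronologicalFuture hn hSig
          (LorentzianMetric.mem_chronologicalFuture_trans hp (hnew u huD' huD)) huSig
    · -- B2: a past endpoint `e ∉ V₀`
      have hne : ∃ e, HasPastEndpoint γ D e := by
        by_contra hno
        push Not at hno
        exact hend ⟨⟨t₀, ht₀D⟩, hno⟩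
      obtain ⟨e, heD⟩ := hne
      have hes : HasPastEndpoint γ s e := by
        rwa [hasPastEndpoint_congr_set (s' := s) ht₀D ht₀
          (fun t ht ↦ ⟨fun h ↦ h.1, fun h ↦ ⟨h, ht⟩⟩)] at heD
      have heV : e ∉ interior DD := fun heV ↦ hpe e heV hes
      -- `t₀` is not the least parameter (else `e = p ∈ V₀`)
      obtain ⟨t', ht's, ht'lt⟩ : ∃ t' ∈ s, t' < t₀ := by
        by_contra hno
        push Not at hno
        have hleast : IsLeast D t₀ := ⟨ht₀D, fun t ht ↦ hno t ht.1⟩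
        have hep : e = p := hasPastEndpoint_unique ⟨t₀, ht₀D⟩ heD (hasPastEndpoint_of_isLeast hleast)
        exact heV (hep ▸ hpV)
      have hep : p ∈ g.chronologicalFuture τ {e} := hEp γ s e hs hγ hes t₀ ht₀ t' ht's ht'lt
      by_cases heSig : e ∈ Sig
      · -- `e ∈ Σ`: then `e ∈ S`, and `hL` puts `e` in `V₀`
        have heS : e ∈ S := mem_of_mem_chronologicalFuture_of_forall_endless hn hSig hS heSig hep hpD
        exact heV (hint (hL e heS))
      rcases mem_chronologicalFuture_or_mem_chronologicalPast hn hSig heSig with he | he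
      · -- `e ∈ I⁺(Σ)`: the open set `I⁺(Σ) ∩ I⁻(p)` contains `e` and lies in `𝔇(S)`
        refine heV (hint ⟨g.chronologicalFuture τ Sig ∩ g.chronologicalPast τ {p},
          ((LorentzianMetric.isOpen_chronologicalFuture_of_boundaryless g τ Sig).inter
            (LorentzianMetric.isOpen_chronologicalPast_of_boundaryless g τ {p})).mem_nhds
            ⟨he, LorentzianMetric.mem_chronologicalPast_of_mem_chronologicalFuture hep⟩,
          fun q hq ↦ ?_⟩)
        exact forall_endless_of_mem_chronologicalPast hn hSig hS hq.1
          (LorentzianMetric.mem_chronologicalFuture_of_mem_chronologicalPast hq.2) hpD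
      · -- `e ∈ I⁻(Σ)`: then `γ t ∈ I⁻(Σ)` near the past end, against `hplus`
        haveI : Nonempty s := ⟨⟨t₀, ht₀⟩⟩
        have hev : ∀ᶠ t : s in atBot, γ t ∈ g.chronologicalPast τ Sig :=
          hes (LorentzianMetric.isOpen_chronologicalPast_of_boundaryless g τ Sig |>.mem_nhds he)
        obtain ⟨t, ht, htle⟩ := (hev.and (eventually_le_atBot (⟨t₀, ht₀⟩ : s))).exists
        exact not_mem_chronologicalPast_of_mem_chronologicalFuture hn hSig (hplus t t.2 htle) ht
  · /- `p ∈ I⁻(Σ)`: the time dual, with the future half `D = s ∩ [t₀, ∞)` -/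
    by_cases hA : ∃ t ∈ s, t₀ ≤ t ∧ γ t ∈ Sig
    · obtain ⟨t, hts, -, htSig⟩ := hA
      exact ⟨t, hts, honSig t hts htSig⟩
    push Not at hA
    exfalso
    have hminus : ∀ t ∈ s, t₀ ≤ t → γ t ∈ g.chronologicalPast τ Sig := by
      intro t hts htle
      rcases eq_or_lt_of_le htle with h | hlt
      · rw [← h]; exact hp
      by_contra hnot
      have hnot' : γ t ∈ g.chronologicalFuture τ Sig :=
        (mem_chronologicalFuture_or_mem_chronologicalPast hn hSig (hA t hts htle)).resolve_right hnot
      obtain ⟨t', ht'I, ht'Sig⟩ := exists_mem_of_isFutureTimelikeCurveOn hn hSig hlt.le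
        (hγ.mono (hs.out ht₀ hts))
        (fun h ↦ not_mem_chronologicalPast_of_mem_chronologicalFuture hn hSig h hp)
        (not_mem_chronologicalPast_of_mem_chronologicalFuture hn hSig hnot')
      exact hA t' (hs.out ht₀ hts ht'I) ht'I.1 ht'Sig
    set D : Set ℝ := s ∩ Ici t₀ with hDdef
    have hDoc : D.OrdConnected := hs.inter ordConnected_Ici
    have ht₀D : t₀ ∈ D := ⟨ht₀, (le_rfl : t₀ ≤ t₀)⟩
    have hDsub : D ⊆ Ici t₀ := inter_subset_right
    have hγD : g.IsFutureTimelikeCurveOn τ γ D := hγ.mono inter_subset_left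
    by_cases hend : IsFutureEndless γ D
    · obtain ⟨Δ, D', hΔ, -, hΔD, hnew⟩ :=
        exists_isEndlessTimelikeCurve_extends_past hn hDoc ht₀D hDsub hγD hend
      obtain ⟨u, ⟨huD', huSig⟩, -⟩ := hSig Δ D' hΔ
      by_cases huD : u ∈ D
      · rw [hΔD u huD] at huSig
        exact hA u huD.1 huD.2 huSig
      · exact not_mem_of_mem_chronologicalPast hn hSig
          (LorentzianMetric.mem_chronologicalFuture_trans (τ := τ.reverse) hp (hnew u huD' huD))
          huSig
    · have hne : ∃ e, HasFutureEndpoint γ D e := by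
        by_contra hno
        push Not at hno
        exact hend ⟨⟨t₀, ht₀D⟩, hno⟩
      obtain ⟨e, heD⟩ := hne
      have hes : HasFutureEndpoint γ s e := by
        rwa [hasFutureEndpoint_congr_set (s' := s) ht₀D ht₀
          (fun t ht ↦ ⟨fun h ↦ h.1, fun h ↦ ⟨h, ht⟩⟩)] at heD
      have heV : e ∉ interior DD := fun heV ↦ hfe e heV hes
      obtain ⟨t', ht's, ht'lt⟩ : ∃ t' ∈ s, t₀ < t' := by
        by_contra hno
        push Not at hno
        have hgr : IsGreatest D t₀ := ⟨ht₀D, fun t ht ↦ hno t ht.1⟩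
        have hep : e = p := hasFutureEndpoint_unique ⟨t₀, ht₀D⟩ heD (hasFutureEndpoint_of_isGreatest hgr)
        exact heV (hep ▸ hpV)
      have hpe : e ∈ g.chronologicalFuture τ {p} := hEf γ s e hs hγ hes t₀ ht₀ t' ht's ht'lt
      by_cases heSig : e ∈ Sig
      · have heS : e ∈ S := mem_of_mem_chronologicalPast_of_forall_endless hn hSig hS heSig hpe hpD
        exact heV (hint (hL e heS))
      rcases mem_chronologicalFuture_or_mem_chronologicalPast hn hSig heSig with he | he
      · -- `e ∈ I⁺(Σ)`: then `γ t ∈ I⁺(Σ)` near the future end, against `hminus`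
        haveI : Nonempty s := ⟨⟨t₀, ht₀⟩⟩
        have hev : ∀ᶠ t : s in atTop, γ t ∈ g.chronologicalFuture τ Sig :=
          hes (LorentzianMetric.isOpen_chronologicalFuture_of_boundaryless g τ Sig |>.mem_nhds he)
        obtain ⟨t, ht, htle⟩ := (hev.and (eventually_ge_atTop (⟨t₀, ht₀⟩ : s))).exists
        exact not_mem_chronologicalPast_of_mem_chronologicalFuture hn hSig ht (hminus t t.2 htle)
      · -- `e ∈ I⁻(Σ)`: the open set `I⁻(Σ) ∩ I⁺(p)` contains `e` and lies in `𝔇(S)`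
        refine heV (hint ⟨g.chronologicalPast τ Sig ∩ g.chronologicalFuture τ {p},
          ((LorentzianMetric.isOpen_chronologicalPast_of_boundaryless g τ Sig).inter
            (LorentzianMetric.isOpen_chronologicalFuture_of_boundaryless g τ {p})).mem_nhds
            ⟨he, hpe⟩, fun q hq ↦ ?_⟩)
        exact forall_endless_of_mem_chronologicalFuture hn hSig hS hq.1 hq.2 hpD

/-- **`S` is a Cauchy hypersurface of every open `V ⊆ V₀ = int 𝔇(S)` which is closed in `V₀`**
(e.g. a connected component of `V₀`), given the local domain-of-dependence property `hL` and
the endpoint lemmas `hEp`, `hEf`: an endless timelike curve of the sub-spacetime `V` is a future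
timelike curve of `M` in `V` with no endpoint in `V₀` (an endpoint in `V₀` would lie in the
closure of `V` relative to `V₀`, hence in `V`), so it meets `S`
(`exists_mem_of_forall_not_hasEndpoint`); at most once, by achronality of `Σ`
(`IsCauchyHypersurface.eq_of_mem_of_mem`). -/
theorem isCauchyHypersurface_restrict_of_localDoD (hn : 2 ≤ n) {Sig S : Set M}
    (hSig : g.IsCauchyHypersurface τ Sig) (hS : S ⊆ Sig)
    (hL : ∀ q ∈ S, ∃ O ∈ 𝓝 q, ∀ p ∈ O, ∀ (δ : ℝ → M) (u : Set ℝ),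
      g.IsEndlessTimelikeCurve τ δ u → ∀ r ∈ u, δ r = p → ∃ r' ∈ u, δ r' ∈ S)
    (hEp : ∀ (γ : ℝ → M) (s : Set ℝ) (e : M), s.OrdConnected → g.IsFutureTimelikeCurveOn τ γ s →
      HasPastEndpoint γ s e → ∀ t ∈ s, ∀ t' ∈ s, t' < t → γ t ∈ g.chronologicalFuture τ {e})
    (hEf : ∀ (γ : ℝ → M) (s : Set ℝ) (e : M), s.OrdConnected → g.IsFutureTimelikeCurveOn τ γ s →
      HasFutureEndpoint γ s e → ∀ t ∈ s, ∀ t' ∈ s, t < t' → e ∈ g.chronologicalFuture τ {γ t})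
    (V : Opens M)
    (hV : (V : Set M) ⊆ interior {p | ∀ (δ : ℝ → M) (u : Set ℝ),
      g.IsEndlessTimelikeCurve τ δ u → ∀ r ∈ u, δ r = p → ∃ r' ∈ u, δ r' ∈ S})
    (hVcl : ∀ e ∈ interior {p | ∀ (δ : ℝ → M) (u : Set ℝ),
      g.IsEndlessTimelikeCurve τ δ u → ∀ r ∈ u, δ r = p → ∃ r' ∈ u, δ r' ∈ S},
      e ∈ closure (V : Set M) → e ∈ V) :
    (g.restrict PseudoRiemannianMetric.contMDiff_restrict_holds V).IsCauchyHypersurface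
      (τ.restrict PseudoRiemannianMetric.contMDiff_restrict_holds τ.contMDiff_restrict_holds V)
      (Subtype.val ⁻¹' S) := by
  intro γ' s hγ'
  have hγ : g.IsFutureTimelikeCurveOn τ (Subtype.val ∘ γ') s :=
    (LorentzianMetric.isFutureTimelikeCurveOn_restrict_iff g τ
      PseudoRiemannianMetric.contMDiff_restrict_holds τ.contMDiff_restrict_holds V).1 hγ'.2.1
  obtain ⟨t₀, ht₀⟩ := hγ'.2.2.1.1
  haveI : Nonempty s := ⟨⟨t₀, ht₀⟩⟩
  have hvals : ∀ t ∈ s, (Subtype.val ∘ γ') t ∈ (V : Set M) := fun t _ ↦ (γ' t).2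
  -- no endpoint in `V₀`
  have hfe : ∀ e ∈ interior {p | ∀ (δ : ℝ → M) (u : Set ℝ),
      g.IsEndlessTimelikeCurve τ δ u → ∀ r ∈ u, δ r = p → ∃ r' ∈ u, δ r' ∈ S},
      ¬ HasFutureEndpoint (Subtype.val ∘ γ') s e := by
    intro e heV h
    have hecl : e ∈ closure (V : Set M) :=
      mem_closure_of_tendsto h (Eventually.of_forall fun t ↦ hvals t t.2)
    have heV' : e ∈ V := hVcl e heV hecl
    exact hγ'.2.2.1.2 ⟨e, heV'⟩ (hasFutureEndpoint_subtypeVal_comp_iff.1 h)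
  have hpe : ∀ e ∈ interior {p | ∀ (δ : ℝ → M) (u : Set ℝ),
      g.IsEndlessTimelikeCurve τ δ u → ∀ r ∈ u, δ r = p → ∃ r' ∈ u, δ r' ∈ S},
      ¬ HasPastEndpoint (Subtype.val ∘ γ') s e := by
    intro e heV h
    have hecl : e ∈ closure (V : Set M) :=
      mem_closure_of_tendsto h (Eventually.of_forall fun t ↦ hvals t t.2)
    have heV' : e ∈ V := hVcl e heV hecl
    exact hγ'.2.2.2.2 ⟨e, heV'⟩ (hasPastEndpoint_subtypeVal_comp_iff.1 h)
  obtain ⟨t, hts, htS⟩ := exists_mem_of_forall_not_hasEndpoint hn hSig hS hL hEp hEf hγ'.1 hγ ht₀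
    (fun t ht ↦ hV (hvals t ht)) hfe hpe
  refine ⟨t, ⟨hts, htS⟩, fun t' ⟨ht's, ht'S⟩ ↦ ?_⟩
  exact LorentzianMetric.IsCauchyHypersurface.eq_of_mem_of_mem hn hSig hγ'.1 hγ ht's hts
    (hS ht'S) (hS htS)

/-- **The globally hyperbolic region of a connected `S ⊆ Σ`**: under `hL`, `hEp`, `hEf` there is
an open connected `V ⊇ S` in which `S` is a Cauchy hypersurface — the connected component of
`S` in `V₀ = int 𝔇(S)` (open as a component of an open subset of the locally connected `M` —
manifolds are locally connected, `ChartedSpace.locallyConnectedSpace`,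
closed in `V₀`; `S ⊆ V₀` by `hL`). This is the shape of the hypothesis `hcauchy` of
`subdataDevelopmentsEmbed_of_hloc_hcauchy_hncb` for the sub-datum `S = ι(Φ N)` of the Cauchy
hypersurface `Σ = ι(X)`. -/
theorem exists_opens_isCauchyHypersurface_of_localDoD [LocallyConnectedSpace M] (hn : 2 ≤ n)
    {Sig S : Set M}
    (hSig : g.IsCauchyHypersurface τ Sig) (hS : S ⊆ Sig) (hSc : IsConnected S)
    (hL : ∀ q ∈ S, ∃ O ∈ 𝓝 q, ∀ p ∈ O, ∀ (δ : ℝ → M) (u : Set ℝ),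
      g.IsEndlessTimelikeCurve τ δ u → ∀ r ∈ u, δ r = p → ∃ r' ∈ u, δ r' ∈ S)
    (hEp : ∀ (γ : ℝ → M) (s : Set ℝ) (e : M), s.OrdConnected → g.IsFutureTimelikeCurveOn τ γ s →
      HasPastEndpoint γ s e → ∀ t ∈ s, ∀ t' ∈ s, t' < t → γ t ∈ g.chronologicalFuture τ {e})
    (hEf : ∀ (γ : ℝ → M) (s : Set ℝ) (e : M), s.OrdConnected → g.IsFutureTimelikeCurveOn τ γ s →
      HasFutureEndpoint γ s e → ∀ t ∈ s, ∀ t' ∈ s, t < t' → e ∈ g.chronologicalFuture τ {γ t}) :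
    ∃ V : Opens M, IsConnected (V : Set M) ∧ S ⊆ V ∧
      (g.restrict PseudoRiemannianMetric.contMDiff_restrict_holds V).IsCauchyHypersurface
        (τ.restrict PseudoRiemannianMetric.contMDiff_restrict_holds τ.contMDiff_restrict_holds V)
        (Subtype.val ⁻¹' S) ∧
      ∀ W : Set M, IsOpen W → IsPreconnected W → (W ∩ S).Nonempty →
        W ⊆ {p | ∀ (δ : ℝ → M) (u : Set ℝ), g.IsEndlessTimelikeCurve τ δ u →
          ∀ r ∈ u, δ r = p → ∃ r' ∈ u, δ r' ∈ S} → W ⊆ V := by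
  set DD : Set M := {p | ∀ (δ : ℝ → M) (u : Set ℝ),
      g.IsEndlessTimelikeCurve τ δ u → ∀ r ∈ u, δ r = p → ∃ r' ∈ u, δ r' ∈ S} with hDD
  have hSV₀ : S ⊆ interior DD := fun q hq ↦ by
    obtain ⟨O, hO, hOD⟩ := hL q hq
    exact mem_interior_iff_mem_nhds.2 (mem_of_superset hO fun p hp ↦ hOD p hp)
  obtain ⟨s₀, hs₀⟩ := hSc.nonempty
  set C : Set M := connectedComponentIn (interior DD) s₀ with hCdef
  have hCo : IsOpen C := isOpen_interior.connectedComponentIn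
  have hSC : S ⊆ C := hSc.isPreconnected.subset_connectedComponentIn hs₀ hSV₀
  have hCsub : C ⊆ interior DD := connectedComponentIn_subset _ _
  refine ⟨⟨C, hCo⟩, ⟨⟨s₀, hSC hs₀⟩, isPreconnected_connectedComponentIn⟩, hSC,
    isCauchyHypersurface_restrict_of_localDoD hn hSig hS hL hEp hEf ⟨C, hCo⟩ hCsub
      fun e heV hecl ↦ ?_, fun W hWo hWc ⟨y, hyW, hyS⟩ hWD ↦ ?_⟩
  swap
  · -- universality: an open preconnected `W` meeting `S` inside `D(S)` lies in `C`
    have hWint : W ⊆ interior DD := interior_maximal hWD hWo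
    have hCy : connectedComponentIn (interior DD) y = C :=
      (connectedComponentIn_eq (hSC hyS)).symm
    have h := hWc.subset_connectedComponentIn hyW hWint
    rw [hCy] at h
    exact h
  -- `C` is closed in `V₀`: `closure C ∩ V₀` is preconnected, contains `s₀`, lies in `V₀`
  have hT : IsPreconnected (closure C ∩ interior DD) :=
    isPreconnected_connectedComponentIn.subset_closure (fun x hx ↦ ⟨subset_closure hx, hCsub hx⟩)
      inter_subset_left
  have hs₀T : s₀ ∈ closure C ∩ interior DD :=
    ⟨subset_closure (mem_connectedComponentIn (hSV₀ hs₀)), hSV₀ hs₀⟩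
  exact hT.subset_connectedComponentIn hs₀T inter_subset_right ⟨hecl, heV⟩

/-- **The globally hyperbolic region of a connected `S ⊆ Σ`, from the local domain-of-dependence
property alone**: `exists_opens_isCauchyHypersurface_of_localDoD` with the endpoint lemmas
discharged (`mem_chronologicalFuture_of_hasPastEndpoint`, `…_of_hasFutureEndpoint`,
`…DoDEndpoint.lean`). -/
theorem exists_opens_isCauchyHypersurface_of_localDoD' [LocallyConnectedSpace M] (hn : 2 ≤ n)
    {Sig S : Set M} (hSig : g.IsCauchyHypersurface τ Sig) (hS : S ⊆ Sig) (hSc : IsConnected S)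
    (hL : ∀ q ∈ S, ∃ O ∈ 𝓝 q, ∀ p ∈ O, ∀ (δ : ℝ → M) (u : Set ℝ),
      g.IsEndlessTimelikeCurve τ δ u → ∀ r ∈ u, δ r = p → ∃ r' ∈ u, δ r' ∈ S) :
    ∃ V : Opens M, IsConnected (V : Set M) ∧ S ⊆ V ∧
      (g.restrict PseudoRiemannianMetric.contMDiff_restrict_holds V).IsCauchyHypersurface
        (τ.restrict PseudoRiemannianMetric.contMDiff_restrict_holds τ.contMDiff_restrict_holds V)
        (Subtype.val ⁻¹' S) ∧
      ∀ W : Set M, IsOpen W → IsPreconnected W → (W ∩ S).Nonempty →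
        W ⊆ {p | ∀ (δ : ℝ → M) (u : Set ℝ), g.IsEndlessTimelikeCurve τ δ u →
          ∀ r ∈ u, δ r = p → ∃ r' ∈ u, δ r' ∈ S} → W ⊆ V :=
  have hn1 : (1 : ℕ∞ω) ≤ n := le_trans one_le_two hn
  exists_opens_isCauchyHypersurface_of_localDoD hn hSig hS hSc hL
    (fun _ _ _ hs hγ he _ ht _ ht' hlt ↦
      mem_chronologicalFuture_of_hasPastEndpoint hn1 hs hγ he ht ht' hlt)
    (fun _ _ _ hs hγ he _ ht _ ht' hlt ↦
      mem_chronologicalFuture_of_hasFutureEndpoint hn1 hs hγ he ht ht' hlt)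

end Assembly

end SubdataDevelopmentsEmbed

end Summit.FinalStateConjecture.FinalStateConjecture.Theorems

end
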